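import Summits.CriticalPhenomena.PercolationContinuityZ3.Theorems.PercNearOneGluingNoHeavyQuantFarSunHairChernoff
import Summits.CriticalPhenomena.PercolationContinuityZ3.Theorems.PercNearOneGluingNoHeavyQuantFarSunHairCert
import HarnessLib

/-!
# FAR beyond trees: the Chernoff bound for `1 − F` (at most two open hairs)

builds on p205010 (kernel theorem, internal audit signed; external expert review pending)

Support file (`--supports stmt-CriticalPhenomena-4575`), seat `prim-cert-1` (gen 39; the theorem and its proof are gen 37's, moved out of …LayerTwoLargeK so
that the slab bounds …Regions/…RegionsB/…RegionsC do not wait for the `K ≥ 85` chain).  For `h ∈ [0,1]` on `range K` and `0 < θ ≤ 1`: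
**`HairyCycle.hairV_univ_ge_of_chernoff`** — `θ²·(1 − F) ≤ e^{−(1−θ)·Σ}` with `F = hairV K h 2 (range K)` and `Σ = Σ_{k<K} h k`, from the lower-tail
Chernoff bound `pow_mul_sum_hairW_count_le_exp` (…HairChernoff).  Elementary [this work]; no sorries; standard axioms.
-/

noncomputable section

namespace Summit.CriticalPhenomena.PercolationContinuityZ3.Theorems.HairyCycle

open Finset

variable {K : ℕ}

/-- **Chernoff for `1 − F`**: `θ²(1 − F) ≤ e^{−(1−θ)Σ}` for `0 < θ ≤ 1`, `h ∈ [0,1]` on `range K`. [this work] -/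
theorem hairV_univ_ge_of_chernoff {h : ℕ → ℝ} (hh : ∀ k, k < K → 0 ≤ h k ∧ h k ≤ 1) {θ : ℝ} (hθ0 : 0 < θ) (hθ1 : θ ≤ 1) :
    θ ^ 2 * (1 - hairV K h 2 (range K)) ≤ Real.exp (-(1 - θ) * ∑ k ∈ range K, h k) := by
  have hc := pow_mul_sum_hairW_count_le_exp hh (range K) 2 hθ0 hθ1
  have hfilt : (range K).filter (fun k => k ∈ range K) = range K := by ext k; simp
  rw [hfilt] at hc
  have hcomp : ∑ Q ∈ (range K).powerset, hairW K h Q * (if (Q ∩ range K).card ≤ 2 then (1 : ℝ) else 0) = 1 - hairV K h 2 (range K) := by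
    unfold hairV
    have htot : ∑ Q ∈ (range K).powerset, hairW K h Q * (if (Q ∩ range K).card ≤ 2 then (1 : ℝ) else 0) +
        ∑ Q ∈ (range K).powerset, hairW K h Q * (if 2 + 1 ≤ (Q ∩ range K).card then (1 : ℝ) else 0) = 1 := by
      rw [← Finset.sum_add_distrib]
      calc ∑ Q ∈ (range K).powerset, (hairW K h Q * (if (Q ∩ range K).card ≤ 2 then (1 : ℝ) else 0) +
              hairW K h Q * (if 2 + 1 ≤ (Q ∩ range K).card then (1 : ℝ) else 0))
          = ∑ Q ∈ (range K).powerset, hairW K h Q := Finset.sum_congr rfl fun Q _ => by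
              by_cases h1 : (Q ∩ range K).card ≤ 2
              · rw [if_pos h1, if_neg (by omega)]; ring
              · rw [if_neg h1, if_pos (by omega)]; ring
        _ = 1 := sum_hairW_eq_one h
    linarith
  rw [hcomp] at hc
  exact hc

end Summit.CriticalPhenomena.PercolationContinuityZ3.Theorems.HairyCycle

end
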